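import Summits.AnomalousDissipation.AnomalousDissipation.Theorems.MarginalStabilityChainStretchedVortexRowsStubLogPotentialSymmetry
import Literature.Analysis.FluidPDE.GaussianVortexKernelRadial
import Literature.Analysis.FluidPDE.PlanarPolarCoords

/-!
# Tools for stub `stub_arnoldHighModes` (crux `CoreLinearInvertibility`,
# stmt-NavierStokesRegularity-17973, route `FilamentSkeletonRss`, line `Sketch`) — part C:
# the logarithmic potential inherits vanishing `k = ±1` circle coefficients

For a continuous Gaussian-bounded density `g` on `ℝ² = EuclideanSpace ℝ (Fin 2)` and its logarithmic
potential `ψ = N ∗ g`, `N = (2π)⁻¹ log ‖·‖`: if `∫_{−π}^{π} g(γ_r) cos = ∫_{−π}^{π} g(γ_r) sin = 0` on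
every circle `γ_r(θ) = (r cos θ, r sin θ)`, `r > 0`, then the same holds for `ψ`. Proof (no Fourier
series, no per-mode formula): for the rotation `R_θ z = cos θ · z + sin θ · z^⊥` (a linear isometry),
`ψ(R_θ ξ₀) = ∫ N(ξ₀ − η) g(R_θ η) dη`; multiply by the weight `w(θ) ∈ {cos θ, sin θ}`, integrate
over `θ ∈ [−π, π]`, and swap the integrals (Fubini, `|N(ξ₀ − η)| B e^{−‖η‖²/8} ∈ L¹`): the inner
angular integral `∫ g(R_θ η) w(θ) dθ` vanishes for `η ≠ 0`, because `R_θ η = γ_{‖η‖}(θ + α)` and after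
the shift `θ ↦ θ − α` the weight `w(θ − α)` is a combination of `cos θ` and `sin θ`.
Adapted from the landed `logPotential_circMean_eq_zero` (the `k = 0` case).

References: Th. Gallay, V. Šverák, arXiv:2110.13739, §2.1 (Fourier decomposition of Arnold's form,
the potential acts mode by mode); folklore.
-/

set_option linter.dupNamespace false

noncomputable section

namespace Summit.NavierStokesRegularity.NavierStokesRegularity.Theorems

open Set Function Filter MeasureTheory Topology Metric WithLp
open Literature.Analysis.FluidPDE
open Summit.AnomalousDissipation.AnomalousDissipation.Theorems.MarginalStabilityChainStretchedVortexRows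
open scoped InnerProductSpace RealInnerProductSpace Real

/-! ### Shifting a weight along a circle -/

/-- **Angle shift against a `2π`-periodic weight**: for continuous `G, w`, both `2π`-periodic,
`∫_{−π}^{π} G(θ + α) w(θ) dθ = ∫_{−π}^{π} G(s) w(s − α) ds`. [folklore] -/
theorem highModes_intervalIntegral_shift {G w : ℝ → ℝ} (hG : Function.Periodic G (2 * π))
    (hw : Function.Periodic w (2 * π)) (α : ℝ) :
    ∫ θ in (-π)..π, G (θ + α) * w θ = ∫ s in (-π)..π, G s * w (s - α) := by
  have h1 : ∫ θ in (-π)..π, G (θ + α) * w θ = ∫ θ in (-π)..π, (fun s => G s * w (s - α)) (θ + α) := by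
    simp only [add_sub_cancel_right]
  rw [h1, intervalIntegral.integral_comp_add_right (fun s => G s * w (s - α)) α]
  have hper : Function.Periodic (fun s => G s * w (s - α)) (2 * π) := fun s => by
    simp only [hG s, show s + 2 * π - α = (s - α) + 2 * π by ring, hw (s - α)]
  have := hper.intervalIntegral_add_eq (-π + α) (-π)
  rw [show -π + α + 2 * π = π + α by ring, show -π + 2 * π = π by ring] at this
  exact this

/-- **The twisted angular integrals vanish along every rotation orbit off the origin**: if
`∫_{−π}^{π} g(γ_r) cos = ∫_{−π}^{π} g(γ_r) sin = 0` for every `r > 0`, then for `η ≠ 0`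
`∫_{−π}^{π} g(R_θ η) cos θ dθ = ∫_{−π}^{π} g(R_θ η) sin θ dθ = 0`, `R_θ η = cos θ · η + sin θ · η^⊥`. [folklore] -/
theorem highModes_intervalIntegral_rotation_eq_zero {g : EuclideanSpace ℝ (Fin 2) → ℝ} (hgc : Continuous g)
    (hmode : ∀ r : ℝ, 0 < r →
      ∫ θ in (-π)..π, g (circlePt r θ) * Real.cos θ = 0 ∧
      ∫ θ in (-π)..π, g (circlePt r θ) * Real.sin θ = 0)
    {η : EuclideanSpace ℝ (Fin 2)} (hη : η ≠ 0) :
    (∫ θ in (-π)..π, g (Real.cos θ • η + Real.sin θ • perp η) * Real.cos θ = 0) ∧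
      ∫ θ in (-π)..π, g (Real.cos θ • η + Real.sin θ • perp η) * Real.sin θ = 0 := by
  obtain ⟨α, hα⟩ := exists_angle_rotation_eq hη
  have hα' : ∀ θ, Real.cos θ • η + Real.sin θ • perp η = circlePt ‖η‖ (θ + α) := hα
  obtain ⟨hc, hs⟩ := hmode ‖η‖ (norm_pos_iff.2 hη)
  obtain ⟨G, hG⟩ : ∃ G : ℝ → ℝ, G = fun s => g (circlePt ‖η‖ s) := ⟨_, rfl⟩
  have hGc : Continuous G := by rw [hG]; exact hgc.comp (continuous_circlePt _)
  have hGper : Function.Periodic G (2 * π) := fun s => by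
    rw [hG]; exact congrArg g (periodic_circlePt ‖η‖ s)
  have hc' : ∫ s in (-π)..π, G s * Real.cos s = 0 := by rw [hG]; exact hc
  have hs' : ∫ s in (-π)..π, G s * Real.sin s = 0 := by rw [hG]; exact hs
  have hGα : ∀ θ, g (Real.cos θ • η + Real.sin θ • perp η) = G (θ + α) := fun θ => by rw [hα', hG]
  simp_rw [hGα]
  have hi1 : IntervalIntegrable (fun s => Real.cos α * (G s * Real.cos s)) volume (-π) π :=
    ((hGc.mul Real.continuous_cos).const_mul _).intervalIntegrable _ _
  have hi2 : IntervalIntegrable (fun s => Real.sin α * (G s * Real.sin s)) volume (-π) π :=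
    ((hGc.mul Real.continuous_sin).const_mul _).intervalIntegrable _ _
  have hi3 : IntervalIntegrable (fun s => Real.cos α * (G s * Real.sin s)) volume (-π) π :=
    ((hGc.mul Real.continuous_sin).const_mul _).intervalIntegrable _ _
  have hi4 : IntervalIntegrable (fun s => Real.sin α * (G s * Real.cos s)) volume (-π) π :=
    ((hGc.mul Real.continuous_cos).const_mul _).intervalIntegrable _ _
  constructor
  · rw [highModes_intervalIntegral_shift hGper Real.cos_periodic α]
    have e : ∀ s, G s * Real.cos (s - α) = Real.cos α * (G s * Real.cos s) + Real.sin α * (G s * Real.sin s) :=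
      fun s => by rw [Real.cos_sub]; ring
    simp_rw [e]
    rw [intervalIntegral.integral_add hi1 hi2, intervalIntegral.integral_const_mul,
      intervalIntegral.integral_const_mul, hc', hs', mul_zero, mul_zero, add_zero]
  · rw [highModes_intervalIntegral_shift hGper Real.sin_periodic α]
    have e : ∀ s, G s * Real.sin (s - α) = Real.cos α * (G s * Real.sin s) - Real.sin α * (G s * Real.cos s) :=
      fun s => by rw [Real.sin_sub]; ring
    simp_rw [e]
    rw [intervalIntegral.integral_sub hi3 hi4, intervalIntegral.integral_const_mul,
      intervalIntegral.integral_const_mul, hc', hs', mul_zero, mul_zero, sub_zero]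

/-! ### The potential against an angular weight -/

section Transfer

variable {B : ℝ} {g : EuclideanSpace ℝ (Fin 2) → ℝ} (hgc : Continuous g)
  (hg0 : ∀ η, |g η| ≤ B * Real.exp (-(1 / 8) * ‖η‖ ^ 2))

include hgc hg0 in
/-- **The potential against an angular weight.** For a continuous bounded weight `w` (`|w| ≤ 1`) whose
twisted angular integrals of `g` vanish along every rotation orbit off the origin,
`∫_{−π}^{π} ψ(γ_r(θ)) w(θ) dθ = 0` for `ψ = N ∗ g` and every `r` (rotate the variable, Fubini). [folklore] -/
theorem highModes_logPotential_circle_weight_eq_zero {w : ℝ → ℝ} (hw : Continuous w)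
    (hw1 : ∀ θ, |w θ| ≤ 1)
    (hrot : ∀ η : EuclideanSpace ℝ (Fin 2), η ≠ 0 →
      ∫ θ in (-π)..π, g (Real.cos θ • η + Real.sin θ • perp η) * w θ = 0) (r : ℝ) :
    ∫ θ in (-π)..π, (∫ η, (2 * Real.pi)⁻¹ * Real.log ‖circlePt r θ - η‖ * g η) * w θ = 0 := by
  -- adapted from `logPotential_circMean_eq_zero` (AnomalousDissipation toolkit)
  have hB : 0 ≤ B := (abs_nonneg _).trans ((hg0 0).trans (le_of_eq (by simp)))
  have hππ : (-π:ℝ) ≤ π := by linarith [Real.pi_pos]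
  obtain ⟨ξ₀, hξ₀⟩ : ∃ x : EuclideanSpace ℝ (Fin 2), x = toLp 2 ![r, 0] := ⟨_, rfl⟩
  have hcirc : ∀ θ : ℝ, circlePt r θ = Real.cos θ • ξ₀ + Real.sin θ • perp ξ₀ := fun θ => by
    rw [hξ₀]; exact circlePoint_eq_rotation r θ
  -- Step 1: rotate the variable of integration
  have hstep : ∀ θ : ℝ, (∫ η, (2 * Real.pi)⁻¹ * Real.log ‖(Real.cos θ • ξ₀ + Real.sin θ • perp ξ₀) - η‖ * g η) =
      ∫ η, (2 * Real.pi)⁻¹ * Real.log ‖ξ₀ - η‖ * g (Real.cos θ • η + Real.sin θ • perp η) := by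
    intro θ
    obtain ⟨R, hR⟩ := exists_planarRotation (Real.cos θ) (Real.sin θ) (Real.cos_sq_add_sin_sq θ)
    have h1 : ∫ η, (2 * Real.pi)⁻¹ * Real.log ‖R ξ₀ - R η‖ * g (R η) =
        ∫ η, (2 * Real.pi)⁻¹ * Real.log ‖R ξ₀ - η‖ * g η :=
      R.measurePreserving.integral_comp R.toHomeomorph.measurableEmbedding
        (fun η => (2 * Real.pi)⁻¹ * Real.log ‖R ξ₀ - η‖ * g η)
    rw [← hR ξ₀, ← h1]
    refine integral_congr_ae (Eventually.of_forall fun η => ?_)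
    beta_reduce
    rw [← map_sub, LinearIsometryEquiv.norm_map, hR η]
  simp_rw [hcirc, hstep]
  -- Step 2: Fubini on `[−π, π] × ℝ²`
  set F : ℝ → EuclideanSpace ℝ (Fin 2) → ℝ := fun θ η =>
    (2 * Real.pi)⁻¹ * Real.log ‖ξ₀ - η‖ * (g (Real.cos θ • η + Real.sin θ • perp η) * w θ) with hF
  have hstep2 : ∀ θ : ℝ, (∫ η, (2 * Real.pi)⁻¹ * Real.log ‖ξ₀ - η‖ * g (Real.cos θ • η + Real.sin θ • perp η)) * w θ =
      ∫ η, F θ η := fun θ => by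
    rw [← integral_mul_const]
    refine integral_congr_ae (Eventually.of_forall fun η => ?_)
    simp only [hF]
    ring
  simp_rw [hstep2]
  have hrotc : Continuous fun p : ℝ × EuclideanSpace ℝ (Fin 2) => Real.cos p.1 • p.2 + Real.sin p.1 • perp p.2 :=
    ((Real.continuous_cos.comp continuous_fst).smul continuous_snd).add
      ((Real.continuous_sin.comp continuous_fst).smul (continuous_perp.comp continuous_snd))
  have hFmeas : Measurable (uncurry F) :=
    ((measurable_const.mul ((measurable_const.sub measurable_snd).norm.log)).mul
      ((hgc.measurable.comp hrotc.measurable).mul (hw.measurable.comp measurable_fst)))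
  have hFm : AEStronglyMeasurable (uncurry F)
      ((volume.restrict (Ioc (-π) π)).prod (volume : Measure (EuclideanSpace ℝ (Fin 2)))) :=
    hFmeas.aestronglyMeasurable
  have hFb : ∀ θ η, ‖F θ η‖ ≤ |(2 * Real.pi)⁻¹ * Real.log ‖ξ₀ - η‖| * (B * Real.exp (-(1 / 8) * ‖η‖ ^ 2)) := by
    intro θ η
    simp only [hF, norm_mul, Real.norm_eq_abs]
    rw [← abs_mul ((2 * Real.pi)⁻¹)]
    refine mul_le_mul_of_nonneg_left ?_ (abs_nonneg _)
    have h1 := hg0 (Real.cos θ • η + Real.sin θ • perp η)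
    rw [norm_cos_smul_add_sin_smul_perp] at h1
    have h2 := hw1 θ
    have h3 : 0 ≤ B * Real.exp (-(1 / 8) * ‖η‖ ^ 2) := by positivity
    calc |g (Real.cos θ • η + Real.sin θ • perp η)| * |w θ|
        ≤ (B * Real.exp (-(1 / 8) * ‖η‖ ^ 2)) * 1 := mul_le_mul h1 h2 (abs_nonneg _) h3
      _ = _ := mul_one _
  have hb := integrable_abs_logKernel_mul_exp hg0 ξ₀
  have hInt : Integrable (uncurry F)
      ((volume.restrict (Ioc (-π) π)).prod (volume : Measure (EuclideanSpace ℝ (Fin 2)))) := by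
    rw [integrable_prod_iff hFm]
    refine ⟨Eventually.of_forall fun θ => hb.mono'
      (hFmeas.comp (measurable_const.prodMk measurable_id)).aestronglyMeasurable
      (Eventually.of_forall (hFb θ)), ?_⟩
    refine (integrable_const (∫ η, |(2 * Real.pi)⁻¹ * Real.log ‖ξ₀ - η‖| *
      (B * Real.exp (-(1 / 8) * ‖η‖ ^ 2)))).mono' hFm.norm.integral_prod_right' (Eventually.of_forall fun θ => ?_)
    rw [Real.norm_of_nonneg (integral_nonneg fun η => norm_nonneg _)]
    exact integral_mono (hb.mono' (hFmeas.comp (measurable_const.prodMk measurable_id)).aestronglyMeasurable.norm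
      (Eventually.of_forall fun η => by rw [norm_norm]; exact hFb θ η)) hb (hFb θ)
  rw [intervalIntegral.integral_of_le hππ, integral_integral_swap hInt]
  -- Step 3: the inner angular integral vanishes off the origin
  refine integral_eq_zero_of_ae ?_
  have hae : ∀ᵐ η ∂(volume : Measure (EuclideanSpace ℝ (Fin 2))), η ≠ 0 := by
    rw [ae_iff]; simp
  filter_upwards [hae] with η hη
  simp only [hF, Pi.zero_apply]
  rw [integral_const_mul, ← intervalIntegral.integral_of_le hππ, hrot η hη, mul_zero]

include hgc hg0 in
/-- **`ψ = N ∗ g` inherits vanishing `k = ±1` circle coefficients from `g`.** [folklore] -/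
theorem highModes_logPotential_modeOne_eq_zero
    (hmode : ∀ r : ℝ, 0 < r →
      ∫ θ in (-π)..π, g (circlePt r θ) * Real.cos θ = 0 ∧
      ∫ θ in (-π)..π, g (circlePt r θ) * Real.sin θ = 0) (r : ℝ) :
    (∫ θ in (-π)..π, (∫ η, (2 * Real.pi)⁻¹ * Real.log ‖circlePt r θ - η‖ * g η) * Real.cos θ = 0) ∧
      ∫ θ in (-π)..π, (∫ η, (2 * Real.pi)⁻¹ * Real.log ‖circlePt r θ - η‖ * g η) * Real.sin θ = 0 :=
  ⟨highModes_logPotential_circle_weight_eq_zero hgc hg0 Real.continuous_cos Real.abs_cos_le_one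
      (fun _ hη => (highModes_intervalIntegral_rotation_eq_zero hgc hmode hη).1) r,
    highModes_logPotential_circle_weight_eq_zero hgc hg0 Real.continuous_sin Real.abs_sin_le_one
      (fun _ hη => (highModes_intervalIntegral_rotation_eq_zero hgc hmode hη).2) r⟩

end Transfer

/-! ### The registered tools stub -/

/-- **Registered tools stub `stub_arnoldHighModesToolsC`** (helpers for `stub_arnoldHighModes`, line
`Sketch` of crux `CoreLinearInvertibility`, stmt-NavierStokesRegularity-17973): for a continuous density
`g` with `|g| ≤ B e^{−‖η‖²/8}` whose `k = ±1` circle coefficients vanish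
(`∫_{−π}^{π} g(γ_r) cos = ∫_{−π}^{π} g(γ_r) sin = 0`, `r > 0`), the logarithmic potential
`ψ = N ∗ g` (`N = (2π)⁻¹ log ‖·‖`) has vanishing `k = ±1` circle coefficients as well. [folklore] -/
theorem stub_arnoldHighModesToolsC :
    ∀ (B : ℝ) (g : EuclideanSpace ℝ (Fin 2) → ℝ), Continuous g →
      (∀ η, |g η| ≤ B * Real.exp (-(1 / 8) * ‖η‖ ^ 2)) →
      (∀ r : ℝ, 0 < r → ∫ θ in (-Real.pi)..Real.pi, g (circlePt r θ) * Real.cos θ = 0 ∧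
        ∫ θ in (-Real.pi)..Real.pi, g (circlePt r θ) * Real.sin θ = 0) →
      ∀ r : ℝ, 0 < r →
        ∫ θ in (-Real.pi)..Real.pi,
            (∫ η, (2 * Real.pi)⁻¹ * Real.log ‖circlePt r θ - η‖ * g η) * Real.cos θ = 0 ∧
          ∫ θ in (-Real.pi)..Real.pi,
            (∫ η, (2 * Real.pi)⁻¹ * Real.log ‖circlePt r θ - η‖ * g η) * Real.sin θ = 0 :=
  fun _ _ hgc hg0 hmode r _ => highModes_logPotential_modeOne_eq_zero hgc hg0 hmode r

end Summit.NavierStokesRegularity.NavierStokesRegularity.Theorems
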